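import Literature.MathematicalPhysics.QuantumFieldTheory.Balaban1983to89.B3GkZeroTorusPointwise
import Literature.MathematicalPhysics.QuantumFieldTheory.Balaban1983to89.B3Sect2StatementsPart2

/-!
# `Balaban1983to89.B3Ineq210ZeroTorus` — T. Bałaban, *(Higgs)₂,₃ quantum fields in a finite volume. III. Renormalization*,
# Commun. Math. Phys. **88** (1983) 411–445 [Balaban1983Higgs3]: the scale decomposition (2.6) p. 424 and the scale-piece bounds
# (2.10) p. 426, `|G^η_{(j)}(Ω,B̃;x,x′)| ≤ O(1)(L^jη)^{−d+2}e^{−δ₁(L^jη)^{−1}|x−x′|}` «and for each differentiation an additional factor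
# (L^jη)^{−1}», PROVED for the TORUS MODEL INSTANCE `A = B̃ = 0`, `Ω = T_η` (the whole torus — the paper's own lattice `T_η`),
# hypothesis-free and uniformly in the volume and the scale: `ScaledKernels.Ineq210 δ₁ C` DISCHARGED for the concrete carrier
# `zeroTorusKernels`

statement-level skeleton of published theorems with citation tags; proofs where landed; nothing here is a claim about the Yang–Mills mass gap

PDF held: `paper:balaban1983-higgs-2-3-quantum-fields-finite-volume` (journal page = PDF page + 410); p. 424 [PDF 14] (2.6) and p. 426
[PDF 16] (2.10) read in the OCR text (`p0014.txt`) and on the render `run/shared/lean/pub/pub-balaban/b2b-balaban-ref1/pages/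
1983-cmp88-higgs23-III/1983-cmp88-higgs23-III-p016-x2.png`; [B4] = T. Bałaban, *Regularity and decay of lattice Green's functions*,
CMP **89** (1983) [Balaban1983RegularityDecay], (2.34)–(2.38) p. 582 and p. 572 (torus) as quoted by `B4Thm110ZeroTorus`.

CITATION HEADER (lean-in-tree rule).  Part of the lit-balaban TYPED SKELETON (HOME `run/shared/lean/pub/lit-balaban/`), Phase 2:
SKELETON rows **B3.Eq2.10** and **B3.Eq2.6** (`HOME/lit-balaban-r15/ROWS-B3.md`, fold owner r15; decl of record
`B3Sect2StatementsPart2.ScaledKernels.Ineq210`, typed p239134 over the ABSTRACT carrier `ScaledKernels`).  TORUS TWIN of this seat's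
`B3Ineq210ZeroBox` (p253409: the same rows for Neumann boxes `Ω = □`); a thin assembly over p38 g4's `B4Thm110ZeroTorus`
([B4] (1.10) on the torus at `A = 0`: the kernel-level (2.34), `term_eq_rescaled`, `derivGrsQks_apply`, `derivG0unit_bound`, the
hypothesis-free kernel inputs `kerBounds_torus`), p39 g5's `B3GkZeroTorusPointwise` (`term_entry_bound` — the three-kernel convolution
of one term, entrywise; `exp_block_le` — block distance vs fine distance) and p37/p16's `B5Leaf237C0Torus.G0unit_decay`; nothing of
these is re-proved.

WHAT IS PRINTED (B3 p. 424/426): *"… decomposing all the propagators corresponding to the lines of G′ according to the equality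
G_k(Ω,B̃) = Σ_{j=0}^{k−1} G^η_{(j)}(Ω,B̃) (2.6)"*; *"For the propagators G^η_{(j)} we apply the inequality |G^η_{(j)}(Ω, B̃; x, x′)| ≤
O(1)(L^jη)^{−d+2}e^{−δ₁(L^jη)^{−1}|x−x′|}, (2.10) and if the propagator is differentiated, then for each differentiation, there is an
additional factor (L^jη)^{−1} on the right side. … They all are obtained by rescaling from the η-lattice to the L^{−j}-lattice and
application of Propositions I.2.1 and I.2.3."*

WHAT IS REPRODUCED (kind «model-instance», G.1 of `HOME/PHASE2-TARGETS.md`).  On Bałaban's CONCRETE scalar torus tower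
`B1RG242Torus.tower P a msq` (volume `P = (d, L, m, K)`, finest torus `T^{(0)} = Site P 0` with `2L^{m+K}` sites per direction,
`η = ε = L^{−K}`, `U ≡ 1`; `G^ε_k = G_k(T_η, 0)`):
* §1 the pieces `pieceT P a msq k j` (`G^η_{(0)} = G^ε_1 = C^{(0),η}`, `G^η_{(j)} = term_j` of [B4] (2.34) for `1 ≤ j < k`, `0` beyond)
  and **(2.6)**: `Σ_{j<k} pieceT j = G^ε_k` (`sum_pieceT`, from `display243`);
* §2 entry formulas (`term_apply`, `deriv_term_apply` — one power of `L^jε` fewer and `K1_j` in front, `deriv_G_one_apply`);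
* §3 at one volume under the kernel inputs (`KerBounds`, `hG0`): `abs_pieceT_le_of` (VALUE: `η^{−d}|G_{(j)}(x,x′)| ≤
  C_val(L^jη)²((L^jη)^d)^{−1}e^{−min(δ₀,δ/2)|x−x′|_T/L^j}`) and `abs_derivPieceT_le_of` (DERIVATIVE: one factor `L^jη` instead of two);
* §4 the CARRIER `zeroTorusKernels P a msq k : ScaledKernels` (`Site = Site P 0`, `dist x x′ = η·|x−x′|_T`, `scale j = L^jη =
  P.spacing j` by `rfl`, `absG = η^{−d}|piece|`, `absDG = η^{−d}|∂^η_μ piece|`; the (2.5)/(2.11)/(2.12) fields NOT modelled) and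
  **`ineq210_zeroTorus`**: for `d ≥ 1`, odd `L > 1`, `a > 0`, `m² ≥ 0`, `∃ δ₁ C > 0` (functions of `d, L, a, m²`) such that for EVERY
  volume with these `d, L` and every scale `1 ≤ k ≤ K`, `(zeroTorusKernels P a msq k).Ineq210 δ₁ C`; §5 a witness volume.

HONEST SCOPE / DECLARED DIVERGENCES (F7).  (i) `A = B̃ = 0` (`U ≡ 1`, one component), `Ω = T_η` the WHOLE torus (B4 p. 572: the
periodic parallelepiped; not subsets `Ω ⊂ T_η`, not `δG_k`), the scope of `B4Thm110ZeroTorus`; torus sides `2L^{m+K}` (the tower's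
convention, `Setup`/`TorusGeometry`, odd `L`).  (ii) `|x − x′|` = the sup torus distance `B5Ineq137Torus.T` in fine units times `η`
(the print's Euclidean distance ≥ it: the exponent follows with `δ₁/√d`).  (iii) The derivative = the left `ε`-difference
`B1RG242Torus.deriv P 0 ε μ` in the row variable.  (iv) Mass and `a`: FIXED `a > 0`, `m² ≥ 0` for the family (B4's `a`, (1.6)), not
a window; constants depend on `d, L, a, m²`, uniform in the volume `(m, K)`, the scale `k ≤ K` and `j`; existential (no numerical
values).  (v) ROUTE = the print's («rescaling … and application of Propositions I.2.1 and I.2.3» = [B4] (2.34) + Lemma 2.4 on the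
torus), through kernel-proved tree files used BY NAME; no Literature fact minted (`pieceT`, `zeroTorusKernels` are concrete `def`s;
the theorems are proved); standard axioms.  Value = kernel certificate of a located by-reference step of B3 on the paper's own
lattice `T_η` at zero background, NOT summit progress.
Unit `lit-balaban-p03-g4` (Phase-2 proof seat p03, gen 4); HOME `run/shared/lean/pub/lit-balaban/` (rows B3.Eq2.6/2.10, FILED.md, STATUS.md).
-/

namespace Literature.MathematicalPhysics.QuantumFieldTheory.Balaban1983to89.B3Ineq210ZeroTorus

open Matrix B1RG242Torus B5Display136Torus B5Leaf237C0Torus B4Ineq115Torus B5Ineq137Torus B4Ineq116Torus B4Thm110ZeroTorus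
open B3GkZeroTorusPointwise (term_entry_bound exp_block_le)
open B3Sect2StatementsPart2

noncomputable section

variable (P : Params)

/-! ## §1 The scale pieces `G^η_{(j)}` of (2.6) on the torus and the identity (2.6) -/

/-- **The scale pieces of (2.6) for the model instance `A = B̃ = 0`, `Ω = T_η` (the whole torus)** on Bałaban's concrete scalar
torus tower (`B1RG242Torus.tower P a msq`, `U ≡ 1`, finest lattice `T^{(0)} = Site P 0`, `η = ε = L^{−K}`):
`G^η_{(0)} = C^{(0),η} = G^ε_1 = ε²G_0^{unit}`, `G^η_{(j)} = a_j²(L^jη)^{−4}G^η_jQ_j^*C^{(j)}Q_jG^η_j = term_j` of [B4] (2.34) for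
`1 ≤ j ≤ k − 1`, and `0` for `j ≥ k`. [cite: Balaban1983Higgs3, (2.6) p.424] -/
def pieceT (a msq : ℝ) (k j : ℕ) : Matrix (Site P 0) (Site P 0) ℝ :=
  if j = 0 then (tower P a msq).G 1 else if j < k then (tower P a msq).term j else 0

variable {P}

section Pieces

variable {a msq : ℝ} {k j : ℕ}

/-- `G^η_{(0)} = G^ε_1 = C^{(0),η}`. [cite: Balaban1983Higgs3, (2.6) p.424] -/
theorem pieceT_zero : pieceT P a msq k 0 = (tower P a msq).G 1 := by simp [pieceT]

/-- `G^η_{(j)} = term_j` for `1 ≤ j < k`. [cite: Balaban1983Higgs3, (2.6) p.424] -/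
theorem pieceT_of_pos (hj1 : 1 ≤ j) (hjk : j < k) : pieceT P a msq k j = (tower P a msq).term j := by
  unfold pieceT; rw [if_neg (by omega), if_pos hjk]

/-- no pieces beyond `j = k − 1`. [cite: Balaban1983Higgs3, (2.6) p.424] -/
theorem pieceT_of_le (hj1 : 1 ≤ j) (hkj : k ≤ j) : pieceT P a msq k j = 0 := by
  unfold pieceT; rw [if_neg (by omega), if_neg (by omega)]

/-- **(2.6) for the torus model instance**: `Σ_{j=0}^{k−1} G^η_{(j)} = G_k(T_η, 0) = G^ε_k` (`B1RG242Torus.display243`, kernel-proved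
from [Balaban1982Higgs1] (2.42)). [cite: Balaban1983Higgs3, (2.6) p.424] -/
theorem sum_pieceT (ha : 0 < a) (hm : 0 ≤ msq) (hk : 1 ≤ k) :
    ∑ j ∈ Finset.range k, pieceT P a msq k j = (tower P a msq).G k := by
  obtain ⟨n, rfl⟩ : ∃ n, k = n + 1 := ⟨k - 1, by omega⟩
  rw [Finset.sum_range_succ', pieceT_zero, display243 P ha hm (n + 1) hk, Finset.sum_Ico_eq_sum_range]
  congr 1
  refine Finset.sum_congr (by simp) fun i hi => ?_
  have hi' := Finset.mem_range.1 hi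
  rw [pieceT_of_pos (by omega) (by omega), add_comm]

end Pieces

/-! ## §2 Entry formulas: a term of (2.34), its left `ε`-derivative, and the derivative of the `j = 0` piece -/

section Entries

variable {a msq : ℝ}

/-- The `(x, x′)` entry of the `j`-th term: `term_j(x,x′) = a_j²(L^jε)²·Σ_{y,y′}(G_j^{resc}Q_j^*)(x,y)C^{(j)}(y,y′)(Q_jG_j^{resc})(y′,x′)`
(`B4Thm110ZeroTorus.term_eq_rescaled`). [cite: Balaban1983RegularityDecay, (2.34) p.582; Balaban1983Higgs3, (2.6) p.424] -/
theorem term_apply (ha : 0 < a) (hm : 0 ≤ msq) {j : ℕ} (hj1 : 1 ≤ j) (x x' : Site P 0) :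
    (tower P a msq).term j x x' = B1.aSeq a P.L j ^ 2 * P.spacing j ^ 2 *
      ∑ y : Site P j, ∑ y' : Site P j,
        (Grs P a msq j * Qks P j) x y * Crs P a msq j y y' * (Qk P j * Grs P a msq j) y' x' := by
  rw [term_eq_rescaled P ha hm hj1, Matrix.smul_apply, smul_eq_mul, triple_apply]

/-- The `(x, x′)` entry of the left `ε`-derivative of the `j`-th term: one power of `L^jε` fewer and the kernel `K1_j` in front
(`B4Thm110ZeroTorus.derivGrsQks_apply`). [cite: Balaban1983RegularityDecay, (2.34), (2.38) p.582; Balaban1983Higgs3, (2.10) p.426] -/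
theorem deriv_term_apply (ha : 0 < a) (hm : 0 ≤ msq) {j : ℕ} (hj1 : 1 ≤ j) (μ : Fin P.d) (x x' : Site P 0) :
    (deriv P 0 P.eps μ * (tower P a msq).term j) x x' = B1.aSeq a P.L j ^ 2 * P.spacing j *
      ∑ y : Site P j, ∑ y' : Site P j,
        K1 P a msq j μ x ⟨j, y⟩ * Crs P a msq j y y' * (Qk P j * Grs P a msq j) y' x' := by
  have hs : P.spacing j ≠ 0 := (P.spacing_pos j).ne'
  rw [term_eq_rescaled P ha hm hj1, Matrix.mul_smul, Matrix.smul_apply, smul_eq_mul,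
    show deriv P 0 P.eps μ * (Grs P a msq j * Qks P j * Crs P a msq j * (Qk P j * Grs P a msq j))
      = (deriv P 0 P.eps μ * Grs P a msq j * Qks P j) * Crs P a msq j * (Qk P j * Grs P a msq j) by
        simp only [Matrix.mul_assoc],
    triple_apply, Finset.mul_sum, Finset.mul_sum]
  refine Finset.sum_congr rfl fun y _ => ?_
  rw [Finset.mul_sum, Finset.mul_sum]
  refine Finset.sum_congr rfl fun y' _ => ?_
  rw [derivGrsQks_apply P ha hm hj1 μ x y]
  field_simp

/-- kernel: `ε²·∂^ε_μ = ε·∂¹_μ` on the fine torus (as in `B4Thm110ZeroTorus`, private there). [folklore] -/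
private theorem eps_sq_deriv_eps (μ : Fin P.d) : P.eps ^ 2 • deriv P 0 P.eps μ = P.eps • deriv P 0 1 μ := by
  have hε : P.eps ≠ 0 := P.eps_pos.ne'
  have h := deriv_rescale (P := P) (i := 0) (1 : ℝ) (P.eps)⁻¹ μ
  rw [div_inv_eq_mul, one_mul] at h
  rw [h, smul_smul, pow_two, mul_assoc, mul_inv_cancel₀ hε, mul_one]

/-- The left `ε`-derivative of the `j = 0` piece: `∂^ε_μG^ε_1 = ε·∂¹_μG_0^{unit}` (`G^ε_1 = ε²G_0^{unit}`).
[cite: Balaban1983RegularityDecay, (2.34) p.582 at `j = 0`; Balaban1983Higgs3, (2.10) p.426] -/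
theorem deriv_G_one_apply (ha : 0 < a) (hm : 0 ≤ msq) (μ : Fin P.d) (x x' : Site P 0) :
    (deriv P 0 P.eps μ * (tower P a msq).G 1) x x' = P.eps * (deriv P 0 1 μ * G0unit P a msq) x x' := by
  rw [G_one_eq_smul_G0unit (P := P) ha hm, Matrix.mul_smul, ← Matrix.smul_mul, eps_sq_deriv_eps, Matrix.smul_mul,
    Matrix.smul_apply, smul_eq_mul]

end Entries

/-! ## §3 (2.10) at one volume from the kernel inputs: value and derivative clauses of the pieces -/

section OneVolume

variable {a msq : ℝ}

/-- kernel: the scale factors — `ε^{−d}·(L^jε)²·L^{−jd} = (L^jε)²·((L^jε)^d)^{−1}`. [folklore] -/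
private theorem eps_weight_two (j : ℕ) :
    (P.eps ^ P.d)⁻¹ * (P.spacing j ^ 2 * (((P.L : ℝ) ^ j) ^ P.d)⁻¹) = P.spacing j ^ 2 * (P.spacing j ^ P.d)⁻¹ := by
  unfold Params.spacing
  rw [mul_pow ((P.L : ℝ) ^ j) P.eps P.d, mul_inv]
  ring

/-- kernel: `ε^{−d}·(L^jε)·L^{−jd} = (L^jε)·((L^jε)^d)^{−1}`. [folklore] -/
private theorem eps_weight_one (j : ℕ) :
    (P.eps ^ P.d)⁻¹ * (P.spacing j * (((P.L : ℝ) ^ j) ^ P.d)⁻¹) = P.spacing j * (P.spacing j ^ P.d)⁻¹ := by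
  unfold Params.spacing
  rw [mul_pow ((P.L : ℝ) ^ j) P.eps P.d, mul_inv]
  ring

/-- **(2.10), VALUE CLAUSE, piecewise, at one volume under the kernel inputs** (`KerBounds`: [B4] (2.35), (2.37) on the torus;
`hG0`: the `C^{(0)}` kernel bound): in the print's `η^d`-normalisation (`G^η = ε^{−d}G`, `ε = η`),
`|G^η_{(j)}(x,x′)| ≤ C_val·(L^jη)²·((L^jη)^d)^{−1}·e^{−min(δ₀,δ/2)·|x−x′|_T/L^j}` for every `j` and all fine sites — the printed
`O(1)(L^jη)^{−d+2}e^{−δ₁(L^jη)^{−1}|x−x′|}` with `|x − x′| = η|x−x′|_T`. [cite: Balaban1983Higgs3, (2.10) p.426] -/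
theorem abs_pieceT_le_of (ha : 0 < a) (hm : 0 ≤ msq) {k : ℕ} (hkm : k ≤ P.m + P.K) {C δ C₀ δ₀ : ℝ}
    (hC : 0 ≤ C) (hδ : 0 < δ) (hC₀ : 0 ≤ C₀) (hδ₀ : 0 < δ₀) (hK : KerBounds P a msq k C δ)
    (hG0 : ∀ x x' : Site P 0, |G0unit P a msq x x'| ≤ C₀ * Real.exp (-(δ₀ * T P 0 x x')))
    (j : ℕ) (x x' : Site P 0) :
    (P.eps ^ P.d)⁻¹ * |pieceT P a msq k j x x'|
      ≤ (C₀ + a ^ 2 * (C ^ 3 * B4Sect5Proof.latticeConst P.d (δ / 2) ^ 2 * Real.exp δ))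
          * (P.spacing j ^ 2 * (P.spacing j ^ P.d)⁻¹)
          * Real.exp (-(min δ₀ (δ / 2) * (T P 0 x x' / (P.L : ℝ) ^ j))) := by
  have hε := P.eps_pos
  have hεd : 0 < (P.eps ^ P.d)⁻¹ := by positivity
  have hT := T_nonneg P 0 x x'
  have hmid : 0 ≤ a ^ 2 * (C ^ 3 * B4Sect5Proof.latticeConst P.d (δ / 2) ^ 2 * Real.exp δ) := by positivity
  have hsw : 0 ≤ P.spacing j ^ 2 * (P.spacing j ^ P.d)⁻¹ := by have := P.spacing_pos j; positivity
  have hm0 : 0 ≤ min δ₀ (δ / 2) := le_min hδ₀.le (by positivity)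
  rcases Nat.eq_zero_or_pos j with rfl | hj1
  · -- `j = 0`: `ε²G_0^{unit}`
    rw [pieceT_zero, G_one_eq_smul_G0unit (P := P) ha hm, Matrix.smul_apply, smul_eq_mul, abs_mul,
      abs_of_nonneg (by positivity), pow_zero, div_one, P.spacing_zero]
    have h := hG0 x x'
    have hexp : Real.exp (-(δ₀ * T P 0 x x')) ≤ Real.exp (-(min δ₀ (δ / 2) * T P 0 x x')) :=
      Real.exp_le_exp.2 (by nlinarith [min_le_left δ₀ (δ / 2)])
    calc (P.eps ^ P.d)⁻¹ * (P.eps ^ 2 * |G0unit P a msq x x'|)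
        = (P.eps ^ 2 * (P.eps ^ P.d)⁻¹) * |G0unit P a msq x x'| := by ring
      _ ≤ (P.eps ^ 2 * (P.eps ^ P.d)⁻¹) * (C₀ * Real.exp (-(min δ₀ (δ / 2) * T P 0 x x'))) :=
          mul_le_mul_of_nonneg_left (h.trans (mul_le_mul_of_nonneg_left hexp hC₀)) (by positivity)
      _ = C₀ * (P.eps ^ 2 * (P.eps ^ P.d)⁻¹) * Real.exp (-(min δ₀ (δ / 2) * T P 0 x x')) := by ring
      _ ≤ _ := by
          refine mul_le_mul_of_nonneg_right (mul_le_mul_of_nonneg_right (by linarith) (by positivity))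
            (Real.exp_pos _).le
  · rcases Nat.lt_or_ge j k with hjk | hkj
    · -- `1 ≤ j < k`: the term of (2.34)
      have hj : j ≤ P.m + P.K := hjk.le.trans hkm
      rw [pieceT_of_pos hj1 hjk, term_apply ha hm hj1, abs_mul, abs_of_nonneg (by positivity)]
      have hent := term_entry_bound P hC hδ hK hj1 hjk hkm x x' (fun z y => (Grs P a msq j * Qks P j) z y) (hK.gq j hj1 hjk)
      have hblk := exp_block_le P hj (show 0 ≤ δ / 2 by positivity) x x'
      rw [show 2 * (δ / 2) = δ from by ring] at hblk
      have haj : B1.aSeq a P.L j ^ 2 ≤ a ^ 2 :=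
        pow_le_pow_left₀ (B1.aSeq_pos ha (one_lt_cast_L P) hj1).le (B1.aSeq_le ha (one_lt_cast_L P) j hj1) 2
      have hexp : Real.exp (-(δ / 2 * T P 0 x x' / (P.L : ℝ) ^ j))
          ≤ Real.exp (-(min δ₀ (δ / 2) * (T P 0 x x' / (P.L : ℝ) ^ j))) := by
        rw [mul_div_assoc]
        exact Real.exp_le_exp.2 (by
          have : 0 ≤ T P 0 x x' / (P.L : ℝ) ^ j := div_nonneg hT (pow_pos P.cast_L_pos j).le
          nlinarith [min_le_right δ₀ (δ / 2)])
      calc (P.eps ^ P.d)⁻¹ * (B1.aSeq a P.L j ^ 2 * P.spacing j ^ 2 *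
            |∑ y : Site P j, ∑ y' : Site P j,
              (Grs P a msq j * Qks P j) x y * Crs P a msq j y y' * (Qk P j * Grs P a msq j) y' x'|)
          ≤ (P.eps ^ P.d)⁻¹ * (a ^ 2 * P.spacing j ^ 2 *
              (C ^ 3 * (((P.L : ℝ) ^ j) ^ P.d)⁻¹ * B4Sect5Proof.latticeConst P.d (δ / 2) ^ 2 *
                (Real.exp δ * Real.exp (-(δ / 2 * T P 0 x x' / (P.L : ℝ) ^ j))))) := by
            refine mul_le_mul_of_nonneg_left ?_ hεd.le
            refine mul_le_mul (mul_le_mul_of_nonneg_right haj (by positivity))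
              (hent.trans (mul_le_mul_of_nonneg_left hblk (by positivity))) (abs_nonneg _) (by positivity)
        _ = a ^ 2 * (C ^ 3 * B4Sect5Proof.latticeConst P.d (δ / 2) ^ 2 * Real.exp δ) *
              ((P.eps ^ P.d)⁻¹ * (P.spacing j ^ 2 * (((P.L : ℝ) ^ j) ^ P.d)⁻¹)) *
              Real.exp (-(δ / 2 * T P 0 x x' / (P.L : ℝ) ^ j)) := by ring
        _ = a ^ 2 * (C ^ 3 * B4Sect5Proof.latticeConst P.d (δ / 2) ^ 2 * Real.exp δ) *
              (P.spacing j ^ 2 * (P.spacing j ^ P.d)⁻¹) *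
              Real.exp (-(δ / 2 * T P 0 x x' / (P.L : ℝ) ^ j)) := by rw [eps_weight_two]
        _ ≤ a ^ 2 * (C ^ 3 * B4Sect5Proof.latticeConst P.d (δ / 2) ^ 2 * Real.exp δ) *
              (P.spacing j ^ 2 * (P.spacing j ^ P.d)⁻¹) *
              Real.exp (-(min δ₀ (δ / 2) * (T P 0 x x' / (P.L : ℝ) ^ j))) :=
            mul_le_mul_of_nonneg_left hexp (mul_nonneg hmid hsw)
        _ ≤ _ := by
            refine mul_le_mul_of_nonneg_right (mul_le_mul_of_nonneg_right (by linarith) hsw) (Real.exp_pos _).le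
    · -- `j ≥ k`: no piece
      rw [pieceT_of_le hj1 hkj, Matrix.zero_apply, abs_zero, mul_zero]
      positivity

/-- **(2.10), DERIVATIVE CLAUSE, piecewise, at one volume under the kernel inputs** (*"if the propagator is differentiated,
then for each differentiation, there is an additional factor (L^jη)^{−1} on the right side"*): with the left `ε`-difference
derivative in the row variable, `|(∂^η_μG^η_{(j)})(x,x′)| ≤ C_der·(L^jη)·((L^jη)^d)^{−1}·e^{−min(δ₀,δ/2)·|x−x′|_T/L^j}` — the `j ≥ 1`
terms through `K1_j = ∂^{L^{−j}}G_j^{resc}Q_j^*` ([B4] (2.35), second quantity), the `j = 0` piece by `∂^εG^ε_1 = ε∂¹G_0^{unit}`.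
[cite: Balaban1983Higgs3, (2.10) p.426] -/
theorem abs_derivPieceT_le_of (ha : 0 < a) (hm : 0 ≤ msq) {k : ℕ} (hkm : k ≤ P.m + P.K) {C δ C₀ δ₀ : ℝ}
    (hC : 0 ≤ C) (hδ : 0 < δ) (hC₀ : 0 ≤ C₀) (hδ₀ : 0 < δ₀) (hK : KerBounds P a msq k C δ)
    (hG0 : ∀ x x' : Site P 0, |G0unit P a msq x x'| ≤ C₀ * Real.exp (-(δ₀ * T P 0 x x')))
    (j : ℕ) (μ : Fin P.d) (x x' : Site P 0) :
    (P.eps ^ P.d)⁻¹ * |(deriv P 0 P.eps μ * pieceT P a msq k j) x x'|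
      ≤ (2 * C₀ * Real.exp δ₀ + a ^ 2 * (C ^ 3 * B4Sect5Proof.latticeConst P.d (δ / 2) ^ 2 * Real.exp δ))
          * (P.spacing j * (P.spacing j ^ P.d)⁻¹)
          * Real.exp (-(min δ₀ (δ / 2) * (T P 0 x x' / (P.L : ℝ) ^ j))) := by
  have hε := P.eps_pos
  have hεd : 0 < (P.eps ^ P.d)⁻¹ := by positivity
  have hT := T_nonneg P 0 x x'
  have hmid : 0 ≤ a ^ 2 * (C ^ 3 * B4Sect5Proof.latticeConst P.d (δ / 2) ^ 2 * Real.exp δ) := by positivity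
  have hzero : 0 ≤ 2 * C₀ * Real.exp δ₀ := by positivity
  have hsw : 0 ≤ P.spacing j * (P.spacing j ^ P.d)⁻¹ := by have := P.spacing_pos j; positivity
  rcases Nat.eq_zero_or_pos j with rfl | hj1
  · -- `j = 0`: `ε·∂¹G_0^{unit}`
    rw [pieceT_zero, deriv_G_one_apply ha hm, abs_mul, abs_of_nonneg hε.le, pow_zero, div_one, P.spacing_zero]
    have h := derivG0unit_bound P hC₀ hδ₀ hG0 μ x x'
    have hexp : Real.exp (-(δ₀ * T P 0 x x')) ≤ Real.exp (-(min δ₀ (δ / 2) * T P 0 x x')) :=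
      Real.exp_le_exp.2 (by nlinarith [min_le_left δ₀ (δ / 2)])
    calc (P.eps ^ P.d)⁻¹ * (P.eps * |(deriv P 0 1 μ * G0unit P a msq) x x'|)
        = (P.eps * (P.eps ^ P.d)⁻¹) * |(deriv P 0 1 μ * G0unit P a msq) x x'| := by ring
      _ ≤ (P.eps * (P.eps ^ P.d)⁻¹) * (2 * C₀ * Real.exp δ₀ * Real.exp (-(min δ₀ (δ / 2) * T P 0 x x'))) :=
          mul_le_mul_of_nonneg_left (h.trans (mul_le_mul_of_nonneg_left hexp hzero)) (by positivity)
      _ = 2 * C₀ * Real.exp δ₀ * (P.eps * (P.eps ^ P.d)⁻¹) * Real.exp (-(min δ₀ (δ / 2) * T P 0 x x')) := by ring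
      _ ≤ _ := by
          refine mul_le_mul_of_nonneg_right (mul_le_mul_of_nonneg_right (by linarith) (by positivity))
            (Real.exp_pos _).le
  · rcases Nat.lt_or_ge j k with hjk | hkj
    · -- `1 ≤ j < k`
      have hj : j ≤ P.m + P.K := hjk.le.trans hkm
      rw [pieceT_of_pos hj1 hjk, deriv_term_apply ha hm hj1, abs_mul, abs_of_nonneg (by
        have := P.spacing_pos j; positivity)]
      have hent := term_entry_bound P hC hδ hK hj1 hjk hkm x x' (fun z y => K1 P a msq j μ z ⟨j, y⟩) (hK.k1 j hj1 hjk μ)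
      have hblk := exp_block_le P hj (show 0 ≤ δ / 2 by positivity) x x'
      rw [show 2 * (δ / 2) = δ from by ring] at hblk
      have haj : B1.aSeq a P.L j ^ 2 ≤ a ^ 2 :=
        pow_le_pow_left₀ (B1.aSeq_pos ha (one_lt_cast_L P) hj1).le (B1.aSeq_le ha (one_lt_cast_L P) j hj1) 2
      have hexp : Real.exp (-(δ / 2 * T P 0 x x' / (P.L : ℝ) ^ j))
          ≤ Real.exp (-(min δ₀ (δ / 2) * (T P 0 x x' / (P.L : ℝ) ^ j))) := by
        rw [mul_div_assoc]
        exact Real.exp_le_exp.2 (by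
          have : 0 ≤ T P 0 x x' / (P.L : ℝ) ^ j := div_nonneg hT (pow_pos P.cast_L_pos j).le
          nlinarith [min_le_right δ₀ (δ / 2)])
      calc (P.eps ^ P.d)⁻¹ * (B1.aSeq a P.L j ^ 2 * P.spacing j *
            |∑ y : Site P j, ∑ y' : Site P j,
              K1 P a msq j μ x ⟨j, y⟩ * Crs P a msq j y y' * (Qk P j * Grs P a msq j) y' x'|)
          ≤ (P.eps ^ P.d)⁻¹ * (a ^ 2 * P.spacing j *
              (C ^ 3 * (((P.L : ℝ) ^ j) ^ P.d)⁻¹ * B4Sect5Proof.latticeConst P.d (δ / 2) ^ 2 *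
                (Real.exp δ * Real.exp (-(δ / 2 * T P 0 x x' / (P.L : ℝ) ^ j))))) := by
            refine mul_le_mul_of_nonneg_left ?_ hεd.le
            refine mul_le_mul (mul_le_mul_of_nonneg_right haj (P.spacing_pos j).le)
              (hent.trans (mul_le_mul_of_nonneg_left hblk (by positivity))) (abs_nonneg _) (by
                have := P.spacing_pos j; positivity)
        _ = a ^ 2 * (C ^ 3 * B4Sect5Proof.latticeConst P.d (δ / 2) ^ 2 * Real.exp δ) *
              ((P.eps ^ P.d)⁻¹ * (P.spacing j * (((P.L : ℝ) ^ j) ^ P.d)⁻¹)) *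
              Real.exp (-(δ / 2 * T P 0 x x' / (P.L : ℝ) ^ j)) := by ring
        _ = a ^ 2 * (C ^ 3 * B4Sect5Proof.latticeConst P.d (δ / 2) ^ 2 * Real.exp δ) *
              (P.spacing j * (P.spacing j ^ P.d)⁻¹) *
              Real.exp (-(δ / 2 * T P 0 x x' / (P.L : ℝ) ^ j)) := by rw [eps_weight_one]
        _ ≤ a ^ 2 * (C ^ 3 * B4Sect5Proof.latticeConst P.d (δ / 2) ^ 2 * Real.exp δ) *
              (P.spacing j * (P.spacing j ^ P.d)⁻¹) *
              Real.exp (-(min δ₀ (δ / 2) * (T P 0 x x' / (P.L : ℝ) ^ j))) :=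
            mul_le_mul_of_nonneg_left hexp (mul_nonneg hmid hsw)
        _ ≤ _ := by
            refine mul_le_mul_of_nonneg_right (mul_le_mul_of_nonneg_right (by linarith) hsw) (Real.exp_pos _).le
    · -- `j ≥ k`
      rw [pieceT_of_le hj1 hkj, Matrix.mul_zero, Matrix.zero_apply, abs_zero, mul_zero]
      positivity

end OneVolume

/-! ## §4 The concrete TORUS carrier of B3 (2.5)/(2.10)–(2.12) and `Ineq210` DISCHARGED, hypothesis-free and volume-uniform -/

/-- **The concrete carrier of B3 (2.5)/(2.10)–(2.12) for the MODEL INSTANCE `A = B̃ = 0`, `Ω = T_η` (the whole torus)** at the scale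
`k` of the volume `P = (d, L, m, K)`: sites `x ∈ T^{(0)} = Site P 0` (finest lattice, `η = ε = L^{−K}`), `dist x x′ = η·|x − x′|_T`
(sup torus distance, in `η`-units), `L`, `η = ε`, `d`, `absG j x x′ = |G^η_{(j)}(x,x′)| = η^{−d}|piece_j(x,x′)|` (the print's kernel
w.r.t. the `η^d`-weighted sum), `absDG j μ x x′ = |(∂^η_μG^η_{(j)})(x,x′)|` (left difference derivative in the row variable);
the fields of (2.5), (2.11), (2.12) are NOT modelled (set to `0`; nothing is claimed about them).  By (2.6) (`sum_pieceT`)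
`Σ_{j<k}` of the pieces is `G_k(T_η,0) = G^ε_k`. [cite: Balaban1983Higgs3, (2.6) p.424, (2.10) p.426] -/
def zeroTorusKernels (P : Params) (a msq : ℝ) (k : ℕ) : ScaledKernels where
  Site := Site P 0
  Bond := PUnit
  Dir := Fin P.d
  LocFn := PUnit
  dist := fun x x' => P.eps * T P 0 x x'
  dist2 := fun _ _ _ => 0
  distBlock := fun _ _ _ => 0
  distSupp := fun _ _ => 0
  distΩ₂ := 0
  L := P.L
  η := P.eps
  d := P.d
  eRun := 0
  pRun := 0
  one_lt_L := one_lt_cast_L P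
  η_pos := P.eps_pos
  absG := fun j x x' => (P.eps ^ P.d)⁻¹ * |pieceT P a msq k j x x'|
  absDG := fun j μ x x' => (P.eps ^ P.d)⁻¹ * |(deriv P 0 P.eps μ * pieceT P a msq k j) x x'|
  holderDiff := fun _ _ _ _ _ => 0
  absGavg := fun _ _ _ => 0
  normDeltaG := fun _ _ _ => 0
  norm116 := fun _ _ _ _ _ => 0

section Carrier

variable {a msq : ℝ} {k : ℕ}

/-- the carrier's `L^jη` is the tower's spacing `L^jε`. [cite: Balaban1983Higgs3, (2.10) p.426] -/
theorem scaleT_eq (j : ℕ) : (zeroTorusKernels P a msq k).scale j = P.spacing j := rfl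

/-- kernel: `(L^jη)^{2−d} = (L^jη)²·((L^jη)^d)^{−1}` (real exponent). [folklore] -/
private theorem rpow_two_sub (j : ℕ) :
    P.spacing j ^ ((2 : ℝ) - (P.d : ℝ)) = P.spacing j ^ 2 * (P.spacing j ^ P.d)⁻¹ := by
  rw [Real.rpow_sub (P.spacing_pos j), div_eq_mul_inv, Real.rpow_natCast _ P.d, Real.rpow_two]

/-- kernel: `(L^jη)^{1−d} = (L^jη)·((L^jη)^d)^{−1}`. [folklore] -/
private theorem rpow_one_sub (j : ℕ) :
    P.spacing j ^ ((1 : ℝ) - (P.d : ℝ)) = P.spacing j * (P.spacing j ^ P.d)⁻¹ := by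
  rw [Real.rpow_sub (P.spacing_pos j), div_eq_mul_inv, Real.rpow_natCast _ P.d, Real.rpow_one]

/-- kernel: `(L^jη)^{−1}·(η|x−x′|_T) = |x−x′|_T/L^j`. [folklore] -/
private theorem scale_inv_mul_dist (j : ℕ) (x x' : Site P 0) :
    (P.spacing j)⁻¹ * (P.eps * T P 0 x x') = T P 0 x x' / (P.L : ℝ) ^ j := by
  unfold Params.spacing
  rw [mul_inv, mul_assoc, ← mul_assoc (P.eps)⁻¹, inv_mul_cancel₀ P.eps_pos.ne', one_mul, div_eq_inv_mul]

end Carrier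

/-- **B3 (2.10) p. 426 [PDF 16] PROVED FOR THE TORUS MODEL INSTANCE `A = B̃ = 0`, `Ω = T_η`, hypothesis-free and uniform in the
volume and the scale**: for `d ≥ 1`, odd `L > 1`, `a > 0`, `m² ≥ 0` there are `δ₁ > 0`, `C > 0` (functions of `d, L, a, m²`) such
that for EVERY volume `P = (d, L, m, K)` of Bałaban's scalar torus tower and every scale `1 ≤ k ≤ K` (`G_k(T_η, 0) = G^ε_k`,
`η = ε`): `(zeroTorusKernels P a msq k).Ineq210 δ₁ C`, i.e. for all `j`, `x, x′ ∈ T_η`, `μ`: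
`|G^η_{(j)}(x,x′)| ≤ C(L^jη)^{2−d}e^{−δ₁(L^jη)^{−1}|x−x′|}` and `|(D^η_μG^η_{(j)})(x,x′)| ≤ C(L^jη)^{1−d}e^{−δ₁(L^jη)^{−1}|x−x′|}`.
Print: *"For the propagators G^η_{(j)} we apply the inequality |G^η_{(j)}(Ω, B̃; x, x′)| ≤ O(1)(L^jη)^{−d+2}e^{−δ₁(L^jη)^{−1}|x−x′|}, (2.10)
and if the propagator is differentiated, then for each differentiation, there is an additional factor (L^jη)^{−1} on the right
side. … They all are obtained by rescaling from the η-lattice to the L^{−j}-lattice and application of Propositions I.2.1 and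
I.2.3."*  Route: exactly that — the terms of [B4] (2.34) = [B1] (2.43) on the torus (`B1RG242Torus.display243`), [B4] Lemma 2.4
(2.35)/(2.37) on the torus (`B4Thm110ZeroTorus.kerBounds_torus`, hypothesis-free), the three-kernel convolution
(`B3GkZeroTorusPointwise.term_entry_bound`) and the `C^{(0)}` kernel (`B5Leaf237C0Torus.G0unit_decay`).
[cite: Balaban1983Higgs3, (2.10) p.426] -/
theorem ineq210_zeroTorus (d L : ℕ) (hd : 1 ≤ d) (hL : Odd L ∧ 1 < L) {a : ℝ} (ha : 0 < a) {msq : ℝ}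
    (hmsq : 0 ≤ msq) :
    ∃ δ₁ C : ℝ, 0 < δ₁ ∧ 0 < C ∧ ∀ (P : Params), P.d = d → P.L = L →
      ∀ k : ℕ, 1 ≤ k → k ≤ P.K → (zeroTorusKernels P a msq k).Ineq210 δ₁ C := by
  obtain ⟨C, δ, hC, hδ, hK⟩ := kerBounds_torus d L hd hL ha msq
  -- the `j = 0` constants depend on `d, L, a, m²` only; read them off any volume with these `d, L`
  obtain ⟨P₀, hP₀d, hP₀L⟩ : ∃ P₀ : Params, P₀.d = d ∧ P₀.L = L := ⟨⟨d, L, 0, 0, hd, hL⟩, rfl, rfl⟩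
  set C₀ := 2 / gamma0 L a with hC₀def
  set δ₀ := dK0 d L a msq with hδ₀def
  have hC₀ : 0 ≤ C₀ := by
    rw [hC₀def, ← hP₀L]; exact (div_pos two_pos (gamma0_pos (P := P₀) ha)).le
  have hδ₀ : 0 < δ₀ := by rw [hδ₀def, ← hP₀d, ← hP₀L]; exact dK0_pos (P := P₀) ha hmsq
  refine ⟨min δ₀ (δ / 2),
    (2 * C₀ * Real.exp δ₀ + C₀) + a ^ 2 * (C ^ 3 * B4Sect5Proof.latticeConst d (δ / 2) ^ 2 * Real.exp δ) + 1,
    lt_min hδ₀ (by positivity), by positivity, ?_⟩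
  intro P hPd hPL k _ hkK
  have hkm : k ≤ P.m + P.K := hkK.trans (Nat.le_add_left _ _)
  have hcap : P.spacing k ^ 2 * msq ≤ msq := by
    have hs1 : P.spacing k ≤ 1 := by rw [← P.spacing_K]; exact spacing_le_spacing P hkK
    have hs0 := (P.spacing_pos k).le
    calc P.spacing k ^ 2 * msq ≤ 1 * msq := mul_le_mul_of_nonneg_right (pow_le_one₀ hs0 hs1) hmsq
      _ = msq := one_mul _
  have hKB := hK P hPd hPL msq hmsq k hkm hcap
  subst hPd hPL
  have hG0 : ∀ x x' : Site P 0, |G0unit P a msq x x'| ≤ C₀ * Real.exp (-(δ₀ * T P 0 x x')) :=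
    fun x x' => G0unit_decay (P := P) ha hmsq x x'
  intro j x x'
  have hsw2 : 0 ≤ P.spacing j ^ 2 * (P.spacing j ^ P.d)⁻¹ := by have := P.spacing_pos j; positivity
  have hsw1 : 0 ≤ P.spacing j * (P.spacing j ^ P.d)⁻¹ := by have := P.spacing_pos j; positivity
  refine ⟨?_, fun μ => ?_⟩
  · show (P.eps ^ P.d)⁻¹ * |pieceT P a msq k j x x'|
      ≤ ((2 * C₀ * Real.exp δ₀ + C₀) + a ^ 2 * (C ^ 3 * B4Sect5Proof.latticeConst P.d (δ / 2) ^ 2 * Real.exp δ) + 1)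
        * P.spacing j ^ ((2 : ℝ) - (P.d : ℝ))
        * Real.exp (-(min δ₀ (δ / 2) * (P.spacing j)⁻¹ * (P.eps * T P 0 x x')))
    rw [rpow_two_sub, mul_assoc (min δ₀ (δ / 2)) ((P.spacing j)⁻¹), scale_inv_mul_dist]
    refine (abs_pieceT_le_of ha hmsq hkm hC hδ hC₀ hδ₀ hKB hG0 j x x').trans ?_
    refine mul_le_mul_of_nonneg_right (mul_le_mul_of_nonneg_right ?_ hsw2) (Real.exp_pos _).le
    have : 0 ≤ 2 * C₀ * Real.exp δ₀ := by positivity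
    linarith
  · show (P.eps ^ P.d)⁻¹ * |(deriv P 0 P.eps μ * pieceT P a msq k j) x x'|
      ≤ ((2 * C₀ * Real.exp δ₀ + C₀) + a ^ 2 * (C ^ 3 * B4Sect5Proof.latticeConst P.d (δ / 2) ^ 2 * Real.exp δ) + 1)
        * P.spacing j ^ ((1 : ℝ) - (P.d : ℝ))
        * Real.exp (-(min δ₀ (δ / 2) * (P.spacing j)⁻¹ * (P.eps * T P 0 x x')))
    rw [rpow_one_sub, mul_assoc (min δ₀ (δ / 2)) ((P.spacing j)⁻¹), scale_inv_mul_dist]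
    refine (abs_derivPieceT_le_of ha hmsq hkm hC hδ hC₀ hδ₀ hKB hG0 j μ x x').trans ?_
    refine mul_le_mul_of_nonneg_right (mul_le_mul_of_nonneg_right ?_ hsw1) (Real.exp_pos _).le
    linarith

/-! ## §5 Non-vacuity: the binders are inhabited (`d = 3`, `L = 3`, `a = 1`, `m² = 0`; the volume `m = K = 1`, scale `k = 1`) -/

/-- The constants exist and (2.10) holds for an explicit torus volume. [cite: Balaban1983Higgs3, (2.10) p.426] -/
theorem ineq210_zeroTorus_witness :
    ∃ δ₁ C : ℝ, 0 < δ₁ ∧ 0 < C ∧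
      (zeroTorusKernels (⟨3, 3, 1, 1, by norm_num, ⟨⟨1, by norm_num⟩, by norm_num⟩⟩ : Params) 1 0 1).Ineq210 δ₁ C := by
  obtain ⟨δ₁, C, hδ₁, hC, h⟩ :=
    ineq210_zeroTorus 3 3 (by norm_num) ⟨⟨1, by norm_num⟩, by norm_num⟩ (a := 1) one_pos (msq := 0) le_rfl
  exact ⟨δ₁, C, hδ₁, hC, h _ rfl rfl 1 le_rfl le_rfl⟩

end

end Literature.MathematicalPhysics.QuantumFieldTheory.Balaban1983to89.B3Ineq210ZeroTorus
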